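import Summits.QuantumFields.YangMills.Theorems.BalabanUVNodesN07DirectMethod
import Summits.QuantumFields.YangMills.Theorems.BalabanUVNodesN07SectAObjects

/-!
# BalabanUVNodes ∕ N07 ([Balaban1985Variational] Theorem 1 (8) p. 279) — WHAT THE DIRECT METHOD RE-POINTS, and PRINT's INDUCTION ON `k` IN THE
# CLOSED-CLASS CURRENCY: (8) ∕ ₈a's `UkExists` ⟸ «closed-class minimisers are interior»; interior minimisers are critical; a second door for D-B11-2;
# level `1` outright (Sect. A's `V₀`); level `k + 1` from Theorem 1 at level `k` (the inductive background (12)–(13))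

Track A of `YM-PLAN.md` (cell `pub-ymgap`, HUMAN RULING D-0062), DAG node **N07** = [Balaban1985Variational] T. Bałaban, *The variational problem
and background fields in renormalization group method for lattice gauge theories*, Commun. Math. Phys. **102** (1985) 277–309, Theorem 1 p. 279,
Sect. A pp. 279–281, Prop. 7 p. 299, Sect. F pp. 300–305; seat `pub-ymgap-dag-n07-e` (generation 5; module 11b, companion of `…N07DirectMethod`;
`--supports stmt-QuantumFields-19903 --as helper`).  THEOREMS ONLY (0 `def`, 0 `sorry`, standard axioms); nothing imported is modified.

CONTENT (everything over NODE 00's objects `avOfRecord`, `bgReg`, `InUkClassB11`, n07-a's socket `varProblemT`, this lineage's `IsCritOfRecord`):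
* §4 (a) ₈a's G₈a-1 `UkExists F N K k e V` and N07's (8) `Exists8 (varProblemT F N K k R) B₃ ε₁ V` each follow from the non-emptiness of the fibre
  and ONE displayed ∀-sentence — «every minimiser of (5) over the CLOSED class lies in the OPEN class» — the a-priori-estimate species of
  Proposition 7 (ii) ∕ Sect. F's proof of (8) («|∂U_k − 1| < B₃ε₁» STRICTLY), stated for closed-class minimisers (`ukExists_of_closureMinimisers_mem`,
  `exists8_of_closureMinimisers_inU`); (b) an interior closed-class minimiser is a minimiser over the open class, hence CRITICAL (p464601's
  `isCritOfRecord_of_isBackground`); (c) ★ a second located door for D-B11-2 ∕ G-B11-E5R (GLOBAL minimality of `U_k` over (6)), alternative to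
  `B11GlobalMin`'s unprinted convexity lemma `ChartConvex`: print's «unique critical orbit in the space (6)» (Prop. 7, first sentence, in the
  curve-criticality currency) + interiority of ONE closed-class minimiser ⇒ `U_k` minimises (5) over ALL of `𝔘_k(ε₀) ∩ 𝔅_k(V)`
  (`isBackground_of_critUnique_of_interior`; with the direct method plugged in, `…_of_closureMinimisers_inU`).
* §5 PRINT's INDUCTION, CLOSED-CLASS FORM: ★ level `k = 1` OUTRIGHT — for every `V` with (7) the Wilson action attains its minimum on
  `closure 𝔘_1(e) ∩ 𝔅_1(V)`, `e ≥ L³B₃ε₁` admissible (the fibre is inhabited by print's `V₀` of (11): this seat's `sat14_faceSec_levelOne`, p454423);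
  level `k + 1` from `Thm1At` at level `k` (the inductive background (12)–(13): `exists_background13_of_thm1At`, p454423); and ★★ the INDUCTION STEP
  of (8) in print's own architecture «Proposition 7 gives Theorem 1 with worse bounds (ε₀ = O(1)C₁B₃ε₁, C₁ = L³), Sect. F improves them»
  (pp. 299–300, 304–305) with Proposition 7's existence REPLACED by the direct method and the improvement of bounds DISPLAYED
  (`exists8_succ_of_thm1At_of_improvement`; `exists8_levelOne_of_improvement`); ★★★ `exists8_allLevels_of_improvement` — THE EXISTENCE CLAUSE (8) AT
  EVERY LEVEL `k ≤ K` from the improvement-of-bounds ∀-sentences ALONE (level `0` the datum; the inductive background from (8) one level down —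
  `exists_background13_of_exists8`; the direct method; the improvement): everything but the displayed sentence PROVED at NODE 00's objects.

HONEST FRAMING.  Kernel bookkeeping over the companion's direct method; NOTHING of [Balaban1985Variational] asserted or proved — the interiority ∕
improvement-of-bounds ∀-sentences and print's uniqueness of the critical orbit stay DISPLAYED; N07 NOT discharged; COUNT-NEUTRAL (5∕27 unmoved); one
finite four-torus programme at fixed `ε = L^{−K}` — NOT the continuum limit, NOT ℝ⁴, NOT infinite volume, NOT OS, NOT a mass gap, NOT the Clay
problem.  No `instance`, no notation, 0 kit.
-/

noncomputable section

namespace Summit.QuantumFields.YangMills.BalabanUVNodes.N07DirectMethodInduction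

open Set Filter Topology
open Literature.MathematicalPhysics.QuantumFieldTheory.Balaban1983to89
open Literature.MathematicalPhysics.QuantumFieldTheory.Balaban1983to89.T4Continuum (T4Family)
open Literature.MathematicalPhysics.QuantumFieldTheory.Balaban1983to89.Node00
open Literature.MathematicalPhysics.QuantumFieldTheory.Balaban1983to89.ExpMeanLog (deltaSU)
open Literature.MathematicalPhysics.QuantumFieldTheory.Balaban1983to89.B12GaugeOrbits021 (OrbitRel wilsonAction4_eq_of_orbitRel)
open Literature.MathematicalPhysics.QuantumFieldTheory.Balaban1983to89.B11Thm1 (Thm1At Exists8)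
open Literature.MathematicalPhysics.QuantumFieldTheory.Balaban1983to89.B11Thm1CarrierT (RegCarrierT varProblemT exists8_iff
  isBackground_of_subset_of_mem)
open Literature.MathematicalPhysics.QuantumFieldTheory.Balaban1983to89.B11Thm1CarrierTLevelZero (inUkClassB11_mono)
open Literature.MathematicalPhysics.QuantumFieldTheory.Balaban1983to89.BlockAveragingSection (faceSec)
open Summit.QuantumFields.YangMills.BalabanUVNodes.N07SectAObjects (sat14_faceSec_levelOne exists_background13_of_thm1At stepA13_objects
  plaqSmall_faceSec_record)
open Summit.QuantumFields.YangMills.BalabanUVNodes.N07DirectMethod (exists_isBackground_closure_bgReg exists_isBackground_closure_inUkClassB11)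
open scoped Matrix.Norms.L2Operator

/-! ## §4 What the direct method re-points: (8) ∕ `UkExists` ⟸ interiority; interior minimisers are critical; D-B11-2 ⟸ uniqueness + interiority -/

section Consequences

variable {F : T4Family} {N : ℕ} [NeZero N]

/-- **₈a's SOLVABILITY LETTER G₈a-1 ⟸ INTERIORITY.**  If the open-class fibre `bgReg(e) ∩ 𝔅_k(V)` is non-empty (print: the inductive background of
Sect. A (13)) and every minimiser of (5) over the CLOSED class `closure (bgReg e) ∩ 𝔅_k(V)` lies in the OPEN class `bgReg(e)` — the displayed
∀-sentence, a-priori-estimate species of Prop. 7 (ii) ∕ Sect. F's «U_k is in the space (8)» («|∂U − 1| < B₃ε₁» STRICTLY) — then the level-`k`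
problem of [I] (1.1) over `bgReg(e)` is solvable at `V`: `Node00.UkExists F N K k e V` (`e < α₀` admissible as in (53)).
[cite: Balaban1985Variational, Thm 1 (8) p.279, Prop. 7 p.299, pp.304–305; Balaban1987RG1, (1.1) p.260] -/
theorem ukExists_of_closureMinimisers_mem (K k : ℕ) {e α₀ : ℝ} (he : e < α₀) (hα : 0 < α₀)
    (hα3 : (143 * (((((F.P K).d + 4 : ℕ) : ℝ)) ^ 2 / 4) ^ 2) * α₀ ≤ 1 / 3)
    (hα2 : 2 * α₀ ≤ 2 * deltaSU (Fin N) / ((((F.P K).d + 4) * (F.P K).L : ℕ) : ℝ) ^ 2)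
    {V : GaugeField (F.P K) k (SU N)} (hne : ∃ U ∈ bgReg F N K k e, Averaging.iter (avOfRecord F N K) k U = V)
    (hint : ∀ U₀ : GaugeField (F.P K) 0 (SU N),
      IsBackground (avOfRecord F N K) (closure (bgReg F N K k e)) k V U₀ → U₀ ∈ bgReg F N K k e) :
    UkExists F N K k e V := by
  obtain ⟨U₀, h⟩ := exists_isBackground_closure_bgReg K k he hα hα3 hα2 hne
  exact ⟨U₀, isBackground_of_subset_of_mem h subset_closure (hint U₀ h)⟩

/-- **N07's EXISTENCE CLAUSE (8) AT THE SOCKET ⟸ INTERIORITY.**  At n07-a's Theorem-1 carrier `varProblemT F N K k R` (the pin's family member;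
any regularity data `R`): if the open-class fibre `𝔘_k(B₃ε₁) ∩ 𝔅_k(V)` is non-empty and every minimiser of (5) over `closure 𝔘_k(B₃ε₁) ∩ 𝔅_k(V)`
lies in `𝔘_k(B₃ε₁)`, then `B11Thm1.Exists8 (varProblemT F N K k R) B₃ ε₁ V` — (8) in the reading of record D-n07a-2 («the minimum of (5) over
`𝔘_k(B₃ε₁) ∩ 𝔅_k(V)` is ATTAINED in that space»); `B₃ε₁ < α₀` admissible as in (53). [cite: Balaban1985Variational, Thm 1 (8) p.279] -/
theorem exists8_of_closureMinimisers_inU (K k : ℕ) (R : RegCarrierT F N K) {B₃ ε₁ α₀ : ℝ} (he : B₃ * ε₁ < α₀) (hα : 0 < α₀)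
    (hα3 : (143 * (((((F.P K).d + 4 : ℕ) : ℝ)) ^ 2 / 4) ^ 2) * α₀ ≤ 1 / 3)
    (hα2 : 2 * α₀ ≤ 2 * deltaSU (Fin N) / ((((F.P K).d + 4) * (F.P K).L : ℕ) : ℝ) ^ 2)
    {V : GaugeField (F.P K) k (SU N)} (hne : ∃ U, InUkClassB11 F N K k (B₃ * ε₁) U ∧ Averaging.iter (avOfRecord F N K) k U = V)
    (hint : ∀ U₀ : GaugeField (F.P K) 0 (SU N),
      IsBackground (avOfRecord F N K) (closure {U | InUkClassB11 F N K k (B₃ * ε₁) U}) k V U₀ → InUkClassB11 F N K k (B₃ * ε₁) U₀) :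
    Exists8 (varProblemT F N K k R) B₃ ε₁ V := by
  obtain ⟨U₀, h⟩ := exists_isBackground_closure_inUkClassB11 K k he hα hα3 hα2 hne
  exact (exists8_iff R B₃ ε₁ V).2 ⟨U₀, isBackground_of_subset_of_mem h subset_closure (hint U₀ h)⟩

/-- **AN INTERIOR CLOSED-CLASS MINIMISER IS A MINIMISER OVER THE OPEN CLASS** (the open class is part of its closure).
[cite: Balaban1985Variational, (6), (8) p.278 (bookkeeping)] -/
theorem isBackground_of_isBackground_closure_of_mem {K k : ℕ} {reg : Set (GaugeField (F.P K) 0 (SU N))} {V : GaugeField (F.P K) k (SU N)}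
    {U₀ : GaugeField (F.P K) 0 (SU N)} (h : IsBackground (avOfRecord F N K) (closure reg) k V U₀) (hU₀ : U₀ ∈ reg) :
    IsBackground (avOfRecord F N K) reg k V U₀ :=
  isBackground_of_subset_of_mem h subset_closure hU₀

/-- **… HENCE CRITICAL**: an interior minimiser of (5) over `closure 𝔘_k(e) ∩ 𝔅_k(V)` is a critical configuration of (5) on `𝔅_k(V)` (this
lineage's «minimal ⇒ critical», `Node00.isCritOfRecord_of_isBackground`: the open class (2) and the Fermat step).
[cite: Balaban1985Variational, p.299 («U_k is a minimal configuration … critical»), p.300] -/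
theorem isCritOfRecord_of_isBackground_closure {K k : ℕ} {e : ℝ} {V : GaugeField (F.P K) k (SU N)} {U₀ : GaugeField (F.P K) 0 (SU N)}
    (h : IsBackground (avOfRecord F N K) (closure {U | InUkClassB11 F N K k e U}) k V U₀) (hU₀ : InUkClassB11 F N K k e U₀) :
    IsCritOfRecord F N K k V U₀ :=
  isCritOfRecord_of_isBackground (isBackground_of_isBackground_closure_of_mem h hU₀)

/-- ★ **A SECOND LOCATED DOOR FOR D-B11-2 ∕ G-B11-E5R (GLOBAL MINIMALITY OF `U_k` OVER THE SPACE (6)).**  Let `U ∈ 𝔘_k(e) ∩ 𝔅_k(V)` be such that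
EVERY critical configuration of (5) on `𝔅_k(V)` lying in `𝔘_k(e)` is a level-`k` residual-gauge transform of `U` — print's «this orbit is a unique
critical orbit in the space (6)» (Thm 1 p. 279 ∕ Prop. 7 p. 299, first sentence), read in the curve-criticality currency `IsCritOfRecord` of record.
If moreover ONE minimiser of (5) over the CLOSED class `closure 𝔘_k(e) ∩ 𝔅_k(V)` lies in the open class `𝔘_k(e)` (interiority), then `U`
minimises (5) over ALL of `𝔘_k(e) ∩ 𝔅_k(V)`: `IsBackground (avOfRecord F N K) {U | InUkClassB11 F N K k e U} k V U` — the reading of record of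
«minimal orbit» (D-n07a-2), which print's (142) (a STRICT LOCAL minimum) does not deliver; an alternative to `B11GlobalMin`'s unprinted `ChartConvex`.
Proof: the interior closed-class minimiser is critical (§4), so on `U`'s residual orbit, so has `U`'s action (`wilsonAction4_eq_of_orbitRel`).
[cite: Balaban1985Variational, Thm 1 (8) p.279, Prop. 7 p.299, (142) p.299] -/
theorem isBackground_of_critUnique_of_interior {K k : ℕ} {e : ℝ} {V : GaugeField (F.P K) k (SU N)} {U : GaugeField (F.P K) 0 (SU N)}
    (hU : InUkClassB11 F N K k e U) (hUV : Averaging.iter (avOfRecord F N K) k U = V)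
    (huniq : ∀ U' : GaugeField (F.P K) 0 (SU N), InUkClassB11 F N K k e U' → Averaging.iter (avOfRecord F N K) k U' = V →
      IsCritOfRecord F N K k V U' → OrbitRel k U U')
    (hint : ∃ U₀ : GaugeField (F.P K) 0 (SU N),
      IsBackground (avOfRecord F N K) (closure {U | InUkClassB11 F N K k e U}) k V U₀ ∧ InUkClassB11 F N K k e U₀) :
    IsBackground (avOfRecord F N K) {U | InUkClassB11 F N K k e U} k V U := by
  obtain ⟨U₀, h₀, hU₀⟩ := hint
  have hbg : IsBackground (avOfRecord F N K) {U | InUkClassB11 F N K k e U} k V U₀ :=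
    isBackground_of_isBackground_closure_of_mem h₀ hU₀
  have hrel : OrbitRel k U U₀ := huniq U₀ hU₀ h₀.1 (isCritOfRecord_of_isBackground hbg)
  have hA : wilsonAction4 U₀ = wilsonAction4 U := wilsonAction4_eq_of_orbitRel hrel
  exact ⟨hUV, hU, fun U' hU' hU'V => hA.symm.le.trans (hbg.2.2 U' hU' hU'V)⟩

/-- **THE SAME DOOR WITH THE DIRECT METHOD PLUGGED IN**: under print's uniqueness of the critical orbit in `𝔘_k(e) ∩ 𝔅_k(V)` and the displayed
interiority of closed-class minimisers, `U` lies on a minimal orbit of (5) in `𝔘_k(e) ∩ 𝔅_k(V)` — the closed-class minimiser being supplied by §3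
(`e < α₀` admissible as in (53); the fibre is non-empty since it contains `U`). [cite: Balaban1985Variational, Thm 1 (8) p.279, Prop. 7 p.299] -/
theorem isBackground_of_critUnique_of_closureMinimisers_inU (K k : ℕ) {e α₀ : ℝ} (he : e < α₀) (hα : 0 < α₀)
    (hα3 : (143 * (((((F.P K).d + 4 : ℕ) : ℝ)) ^ 2 / 4) ^ 2) * α₀ ≤ 1 / 3)
    (hα2 : 2 * α₀ ≤ 2 * deltaSU (Fin N) / ((((F.P K).d + 4) * (F.P K).L : ℕ) : ℝ) ^ 2)
    {V : GaugeField (F.P K) k (SU N)} {U : GaugeField (F.P K) 0 (SU N)}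
    (hU : InUkClassB11 F N K k e U) (hUV : Averaging.iter (avOfRecord F N K) k U = V)
    (huniq : ∀ U' : GaugeField (F.P K) 0 (SU N), InUkClassB11 F N K k e U' → Averaging.iter (avOfRecord F N K) k U' = V →
      IsCritOfRecord F N K k V U' → OrbitRel k U U')
    (hint : ∀ U₀ : GaugeField (F.P K) 0 (SU N),
      IsBackground (avOfRecord F N K) (closure {U | InUkClassB11 F N K k e U}) k V U₀ → InUkClassB11 F N K k e U₀) :
    IsBackground (avOfRecord F N K) {U | InUkClassB11 F N K k e U} k V U := by
  obtain ⟨U₀, h₀⟩ := exists_isBackground_closure_inUkClassB11 K k he hα hα3 hα2 ⟨U, hU, hUV⟩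
  exact isBackground_of_critUnique_of_interior hU hUV huniq ⟨U₀, h₀, hint U₀ h₀⟩

end Consequences

/-! ## §5 Print's induction on `k` in the closed-class currency: level `1` outright; level `k + 1` from Theorem 1 at level `k` -/

section Induction

variable {F : T4Family} {N : ℕ} [NeZero N]

/-- The radius of (13) dominates the radius of (8): `B₃ε₁ ≤ L³B₃ε₁` (`L ≥ 1`, `B₃, ε₁ ≥ 0`). [cite: Balaban1985Variational, (13) p.280 (bookkeeping)] -/
theorem radius8_le_radius13 {B₃ ε₁ : ℝ} (hB₃ : 0 ≤ B₃) (hε₁ : 0 ≤ ε₁) : B₃ * ε₁ ≤ (F.L : ℝ) ^ 3 * B₃ * ε₁ := by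
  have hL : (1 : ℝ) ≤ (F.L : ℝ) ^ 3 := one_le_pow₀ (by exact_mod_cast F.hL.2.le)
  have h0 : 0 ≤ B₃ * ε₁ := mul_nonneg hB₃ hε₁
  nlinarith

/-- ★ **LEVEL `k = 1`, OUTRIGHT: THE WILSON ACTION ATTAINS ITS MINIMUM ON THE CLOSED CLASS OVER EVERY REGULAR DATUM.**  On the finest torus of the
`K`-th approximation (`K ≥ 1`), for every datum `V` on `T^{(1)}` with (7) `|V(∂p) − 1| < ε₁` (`ε₁ > 0`) and every radius `e ≥ L³B₃ε₁`, `B₃ ≥ 7`,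
`e < α₀` admissible as in (53), there EXISTS a minimiser of (5) over `closure 𝔘_1(e) ∩ 𝔅_1(V)` — the fibre is inhabited by print's `V₀` of (11)
(this seat's `sat14_faceSec_levelOne`, p454423: `V₀ ∈ 𝔘_1(L³B₃ε₁)`, `V̄₀ = V`).  The closed-class companion of Theorem 1 (8) at its first
non-trivial level, hypothesis-free. [cite: Balaban1985Variational, Thm 1 (8) p.279, p.280 («for k = 1 we define U₀ = V₀»), (11), (13)] -/
theorem exists_isBackground_closure_levelOne {K : ℕ} (hK : 1 ≤ K) {B₃ ε₁ e α₀ : ℝ} (hB₃ : 7 ≤ B₃) (hε₁ : 0 < ε₁)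
    (h13 : (F.L : ℝ) ^ 3 * B₃ * ε₁ ≤ e) (he : e < α₀) (hα : 0 < α₀)
    (hα3 : (143 * (((((F.P K).d + 4 : ℕ) : ℝ)) ^ 2 / 4) ^ 2) * α₀ ≤ 1 / 3)
    (hα2 : 2 * α₀ ≤ 2 * deltaSU (Fin N) / ((((F.P K).d + 4) * (F.P K).L : ℕ) : ℝ) ^ 2)
    {V : GaugeField (F.P K) 1 (SU N)} (hV : PlaqSmall ε₁ V) :
    ∃ U₀ : GaugeField (F.P K) 0 (SU N), IsBackground (avOfRecord F N K) (closure {U | InUkClassB11 F N K 1 e U}) 1 V U₀ := by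
  obtain ⟨hU, hUV⟩ := sat14_faceSec_levelOne (N := N) hK hB₃ hε₁ hV
  exact exists_isBackground_closure_inUkClassB11 K 1 he hα hα3 hα2 ⟨faceSec V, inUkClassB11_mono h13 hU, hUV⟩

/-- ★ **(8) AT LEVEL `1` ⟸ THE IMPROVEMENT OF BOUNDS ALONE.**  At the level-`1` member of the pin's family (`varProblemT F N K 1 R`), Theorem 1's
existence clause `Exists8 … B₃ ε₁ V` follows, for every `V` with (7), from ONE displayed ∀-sentence: «every minimiser of (5) over the CLOSED worse
class `closure 𝔘_1(L³B₃ε₁) ∩ 𝔅_1(V)` lies in the better OPEN class `𝔘_1(B₃ε₁)`» — print's Sect. F improvement «we have constructed the minimal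
configuration in the space (2) with ε₀ = O(1)B₃ε₁ … Especially it implies that U_k is in the space (8)» (pp. 304–305), read for closed-class
minimisers; the existence itself is the direct method (§3), not Props 4–7. (`B₃ ≥ 7`, `L³B₃ε₁ < α₀` admissible as in (53).)
[cite: Balaban1985Variational, Thm 1 (8) p.279, pp.304–305] -/
theorem exists8_levelOne_of_improvement {K : ℕ} (hK : 1 ≤ K) (R : RegCarrierT F N K) {B₃ ε₁ α₀ : ℝ} (hB₃ : 7 ≤ B₃) (hε₁ : 0 < ε₁)
    (he : (F.L : ℝ) ^ 3 * B₃ * ε₁ < α₀) (hα : 0 < α₀)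
    (hα3 : (143 * (((((F.P K).d + 4 : ℕ) : ℝ)) ^ 2 / 4) ^ 2) * α₀ ≤ 1 / 3)
    (hα2 : 2 * α₀ ≤ 2 * deltaSU (Fin N) / ((((F.P K).d + 4) * (F.P K).L : ℕ) : ℝ) ^ 2)
    {V : GaugeField (F.P K) 1 (SU N)} (hV : PlaqSmall ε₁ V)
    (himp : ∀ U₀ : GaugeField (F.P K) 0 (SU N),
      IsBackground (avOfRecord F N K) (closure {U | InUkClassB11 F N K 1 ((F.L : ℝ) ^ 3 * B₃ * ε₁) U}) 1 V U₀ →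
        InUkClassB11 F N K 1 (B₃ * ε₁) U₀) :
    Exists8 (varProblemT F N K 1 R) B₃ ε₁ V := by
  obtain ⟨U₀, h⟩ := exists_isBackground_closure_levelOne hK hB₃ hε₁ le_rfl he hα hα3 hα2 hV
  have hsub : {U : GaugeField (F.P K) 0 (SU N) | InUkClassB11 F N K 1 (B₃ * ε₁) U} ⊆
      closure {U | InUkClassB11 F N K 1 ((F.L : ℝ) ^ 3 * B₃ * ε₁) U} :=
    fun U hU => subset_closure (inUkClassB11_mono (radius8_le_radius13 (F := F) (by linarith) hε₁.le) hU)
  exact (exists8_iff R B₃ ε₁ V).2 ⟨U₀, isBackground_of_subset_of_mem h hsub (himp U₀ h)⟩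

/-- ★ **LEVEL `k + 1` FROM THEOREM 1 AT LEVEL `k` (print's inductive assumption): THE CLOSED-CLASS MINIMISER EXISTS.**  Theorem 1 at constants `C` for
the level-`k` member `varProblemT F N K k R₀` and a level-`(k+1)` datum `V` with (7), `0 < ε₁ ≤ a₁`, give the inductive background `U₀ = U_k(V₀)` of
(12)–(13) in `𝔘_{k+1}(L³B₃ε₁) ∩ 𝔅_{k+1}(V)` (this seat's `exists_background13_of_thm1At`, p454423) — so the fibre is inhabited and, for every
`e ≥ L³B₃ε₁` with `e < α₀` admissible, (5) has a minimiser over `closure 𝔘_{k+1}(e) ∩ 𝔅_{k+1}(V)` (`k + 1 ≤ K`).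
[cite: Balaban1985Variational, (12)–(13) p.280, Thm 1 (8) p.279] -/
theorem exists_isBackground_closure_succ_of_thm1At {K k : ℕ} (hk : k + 1 ≤ K) (R₀ : RegCarrierT F N K) {C : B11Thm1.Consts}
    (hT : Thm1At C (varProblemT F N K k R₀)) {ε₁ e α₀ : ℝ} (hε₁ : 0 < ε₁) (hε₁a : ε₁ ≤ C.a₁)
    (h13 : (F.L : ℝ) ^ 3 * C.B₃ * ε₁ ≤ e) (he : e < α₀) (hα : 0 < α₀)
    (hα3 : (143 * (((((F.P K).d + 4 : ℕ) : ℝ)) ^ 2 / 4) ^ 2) * α₀ ≤ 1 / 3)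
    (hα2 : 2 * α₀ ≤ 2 * deltaSU (Fin N) / ((((F.P K).d + 4) * (F.P K).L : ℕ) : ℝ) ^ 2)
    {V : GaugeField (F.P K) (k + 1) (SU N)} (hV : PlaqSmall ε₁ V) :
    ∃ U₀ : GaugeField (F.P K) 0 (SU N),
      IsBackground (avOfRecord F N K) (closure {U | InUkClassB11 F N K (k + 1) e U}) (k + 1) V U₀ := by
  obtain ⟨U₀, -, hU, hUV⟩ := exists_background13_of_thm1At (N := N) hk R₀ hT hε₁ hε₁a hV
  exact exists_isBackground_closure_inUkClassB11 K (k + 1) he hα hα3 hα2 ⟨U₀, inUkClassB11_mono h13 hU, hUV⟩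

/-- ★★ **THE INDUCTION STEP OF THEOREM 1's EXISTENCE CLAUSE, DIRECT-METHOD FORM**: Theorem 1 at constants `C` for the level-`k` member, a
level-`(k+1)` datum `V` with (7) (`0 < ε₁ ≤ a₁`), and the displayed IMPROVEMENT OF BOUNDS at level `k + 1` — «every minimiser of (5) over
`closure 𝔘_{k+1}(L³B₃ε₁) ∩ 𝔅_{k+1}(V)` lies in `𝔘_{k+1}(B₃ε₁)`» (print pp. 304–305, read for closed-class minimisers) — give (8) at level `k + 1` WITH
THE SAME CONSTANT `B₃`: `Exists8 (varProblemT F N K (k + 1) R₁) C.B₃ ε₁ V`.  Print's architecture «Proposition 7 gives Theorem 1 with worse bounds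
(ε₀ = O(1)C₁B₃ε₁, C₁ = L³); Sect. F improves them» (pp. 299–300, 304), with Proposition 7's existence REPLACED by §3 and the improvement DISPLAYED.
(`L³B₃ε₁ < α₀` admissible as in (53); `k + 1 ≤ K`.) [cite: Balaban1985Variational, Thm 1 (8) p.279, (13) p.280, Prop. 7 pp.299–300, pp.304–305] -/
theorem exists8_succ_of_thm1At_of_improvement {K k : ℕ} (hk : k + 1 ≤ K) (R₀ R₁ : RegCarrierT F N K) {C : B11Thm1.Consts}
    (hT : Thm1At C (varProblemT F N K k R₀)) {ε₁ α₀ : ℝ} (hε₁ : 0 < ε₁) (hε₁a : ε₁ ≤ C.a₁)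
    (he : (F.L : ℝ) ^ 3 * C.B₃ * ε₁ < α₀) (hα : 0 < α₀)
    (hα3 : (143 * (((((F.P K).d + 4 : ℕ) : ℝ)) ^ 2 / 4) ^ 2) * α₀ ≤ 1 / 3)
    (hα2 : 2 * α₀ ≤ 2 * deltaSU (Fin N) / ((((F.P K).d + 4) * (F.P K).L : ℕ) : ℝ) ^ 2)
    {V : GaugeField (F.P K) (k + 1) (SU N)} (hV : PlaqSmall ε₁ V)
    (himp : ∀ U₀ : GaugeField (F.P K) 0 (SU N),
      IsBackground (avOfRecord F N K) (closure {U | InUkClassB11 F N K (k + 1) ((F.L : ℝ) ^ 3 * C.B₃ * ε₁) U}) (k + 1) V U₀ →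
        InUkClassB11 F N K (k + 1) (C.B₃ * ε₁) U₀) :
    Exists8 (varProblemT F N K (k + 1) R₁) C.B₃ ε₁ V := by
  obtain ⟨U₀, h⟩ := exists_isBackground_closure_succ_of_thm1At hk R₀ hT hε₁ hε₁a le_rfl he hα hα3 hα2 hV
  have hsub : {U : GaugeField (F.P K) 0 (SU N) | InUkClassB11 F N K (k + 1) (C.B₃ * ε₁) U} ⊆
      closure {U | InUkClassB11 F N K (k + 1) ((F.L : ℝ) ^ 3 * C.B₃ * ε₁) U} :=
    fun U hU => subset_closure (inUkClassB11_mono (radius8_le_radius13 (F := F) C.B₃_pos.le hε₁.le) hU)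
  exact (exists8_iff R₁ C.B₃ ε₁ V).2 ⟨U₀, isBackground_of_subset_of_mem h hsub (himp U₀ h)⟩

/-! ### The whole induction on the existence clause alone -/

/-- **(8) AT LEVEL `0` FOR EVERY `B₃ ≥ 7`** (n07-a's `exists8_levelZero` has `B₃ = 7`; the (2)-class grows with its radius): the minimiser is `V` itself.
[cite: Balaban1985Variational, Thm 1 (8) p.279 (`k = 0`)] -/
theorem exists8_levelZero_of_le (K : ℕ) (R : RegCarrierT F N K) {B₃ ε₁ : ℝ} (hB₃ : 7 ≤ B₃) (hε₁ : 0 < ε₁) (V : GaugeField (F.P K) 0 (SU N))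
    (hV : PlaqSmall ε₁ V) : Exists8 (varProblemT F N K 0 R) B₃ ε₁ V :=
  (exists8_iff R B₃ ε₁ V).2 ⟨V, (B11Thm1LevelZero.isBackground_zero_iff _ _ V V).2
    ⟨rfl, inUkClassB11_mono (mul_le_mul_of_nonneg_right hB₃ hε₁.le) (B11Thm1LevelZero.inUkClassB11_zero_of_plaqSmall F N K hε₁ hV)⟩⟩

/-- **THE INDUCTIVE BACKGROUND (12)–(13) FROM THE EXISTENCE CLAUSE ALONE**: (8) at level `k` for the datum `V₀ = faceSec V` (any `B₃, ε₁ ≥ 0`) gives a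
configuration in `𝔘_{k+1}(L³B₃ε₁) ∩ 𝔅_{k+1}(V)` — this seat's `stepA13_objects` (p454423) fed with the minimiser of (8) instead of the whole of
Theorem 1 (g0's `exists_background13_of_thm1At` uses only this conjunct). [cite: Balaban1985Variational, (12)–(13) p.280] -/
theorem exists_background13_of_exists8 {K k : ℕ} (hk : k + 1 ≤ K) (R₀ R₁ : RegCarrierT F N K) {B₃ ε₁ : ℝ} (hB₃ : 0 ≤ B₃) (hε₁ : 0 ≤ ε₁)
    {V : GaugeField (F.P K) (k + 1) (SU N)} (hE : Exists8 (varProblemT F N K k R₀) B₃ ε₁ (faceSec V)) :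
    ∃ U₀ : GaugeField (F.P K) 0 (SU N),
      InUkClassB11 F N K (k + 1) ((F.L : ℝ) ^ 3 * B₃ * ε₁) U₀ ∧ Averaging.iter (avOfRecord F N K) (k + 1) U₀ = V := by
  obtain ⟨U₀, hU, hB, -⟩ := hE
  obtain ⟨hU', hB'⟩ := stepA13_objects hk R₀ R₁ (mul_nonneg hB₃ hε₁) hU hB
  exact ⟨U₀, by rwa [← mul_assoc] at hU', hB'⟩

/-- ★★★ **THE EXISTENCE CLAUSE (8) OF THEOREM 1 AT EVERY LEVEL `k ≤ K`, FROM THE IMPROVEMENT OF BOUNDS ALONE.**  Fix `B₃ ≥ 7`, `a₁ > 0` with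
`L³B₃a₁ < α₀` admissible as in (53), and residual regularity data `R k` at every level (the existence clause does not read them).  DISPLAYED, one
∀-sentence per level `1 ≤ j ≤ K`: «for every datum `V` on `T^{(j)}` with (7) at `ε₁ ≤ a₁`, every minimiser of (5) over the CLOSED worse class
`closure 𝔘_j(L³B₃ε₁) ∩ 𝔅_j(V)` lies in the better class `𝔘_j(B₃ε₁)`» (print's Sect. F improvement, pp. 304–305, read for closed-class minimisers).
CONCLUSION: `Exists8 (varProblemT F N K k (R k)) B₃ ε₁ V` for EVERY `k ≤ K`, `0 < ε₁ ≤ a₁`, `V` with (7) — print's induction on `k` (p. 279 «will be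
proved by induction with respect to k»; level `0`: the datum itself; level `k + 1`: the inductive background (11)–(13) from (8) at level `k`, then the
DIRECT METHOD over the closed worse class (companion §3), then the improvement).  Everything except the displayed sentence is PROVED at NODE 00's
objects. [cite: Balaban1985Variational, Thm 1 (8) p.279, (11)–(13) pp.279–280, Prop. 7 pp.299–300, pp.304–305] -/
theorem exists8_allLevels_of_improvement (K : ℕ) (R : ℕ → RegCarrierT F N K) {B₃ a₁ α₀ : ℝ} (hB₃ : 7 ≤ B₃) (ha₁ : 0 < a₁)
    (he : (F.L : ℝ) ^ 3 * B₃ * a₁ < α₀) (hα : 0 < α₀)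
    (hα3 : (143 * (((((F.P K).d + 4 : ℕ) : ℝ)) ^ 2 / 4) ^ 2) * α₀ ≤ 1 / 3)
    (hα2 : 2 * α₀ ≤ 2 * deltaSU (Fin N) / ((((F.P K).d + 4) * (F.P K).L : ℕ) : ℝ) ^ 2)
    (himp : ∀ j : ℕ, 1 ≤ j → j ≤ K → ∀ ε₁ : ℝ, 0 < ε₁ → ε₁ ≤ a₁ → ∀ V : GaugeField (F.P K) j (SU N), PlaqSmall ε₁ V →
      ∀ U₀ : GaugeField (F.P K) 0 (SU N),
        IsBackground (avOfRecord F N K) (closure {U | InUkClassB11 F N K j ((F.L : ℝ) ^ 3 * B₃ * ε₁) U}) j V U₀ →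
          InUkClassB11 F N K j (B₃ * ε₁) U₀) :
    ∀ k : ℕ, k ≤ K → ∀ ε₁ : ℝ, 0 < ε₁ → ε₁ ≤ a₁ → ∀ V : GaugeField (F.P K) k (SU N), PlaqSmall ε₁ V →
      Exists8 (varProblemT F N K k (R k)) B₃ ε₁ V
  | 0, _, ε₁, hε₁, _, V, hV => exists8_levelZero_of_le K (R 0) hB₃ hε₁ V hV
  | k + 1, hk, ε₁, hε₁, hε₁a, V, hV => by
    have hB₃0 : 0 ≤ B₃ := by linarith
    have hE := exists8_allLevels_of_improvement K R hB₃ ha₁ he hα hα3 hα2 himp k (Nat.le_of_succ_le hk) ε₁ hε₁ hε₁a (faceSec V)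
      (plaqSmall_faceSec_record hk hε₁ hV)
    obtain ⟨U₀, hU, hUV⟩ := exists_background13_of_exists8 hk (R k) (R (k + 1)) hB₃0 hε₁.le hE
    have he' : (F.L : ℝ) ^ 3 * B₃ * ε₁ < α₀ :=
      (mul_le_mul_of_nonneg_left hε₁a (by positivity : (0 : ℝ) ≤ (F.L : ℝ) ^ 3 * B₃)).trans_lt he
    obtain ⟨U₁, h⟩ := exists_isBackground_closure_inUkClassB11 K (k + 1) he' hα hα3 hα2 ⟨U₀, hU, hUV⟩
    have hsub : {U : GaugeField (F.P K) 0 (SU N) | InUkClassB11 F N K (k + 1) (B₃ * ε₁) U} ⊆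
        closure {U | InUkClassB11 F N K (k + 1) ((F.L : ℝ) ^ 3 * B₃ * ε₁) U} :=
      fun U hU => subset_closure (inUkClassB11_mono (radius8_le_radius13 (F := F) hB₃0 hε₁.le) hU)
    exact (exists8_iff (R (k + 1)) B₃ ε₁ V).2
      ⟨U₁, isBackground_of_subset_of_mem h hsub (himp (k + 1) (Nat.succ_pos k) hk ε₁ hε₁ hε₁a V hV U₁ h)⟩

end Induction

end Summit.QuantumFields.YangMills.BalabanUVNodes.N07DirectMethodInduction

end
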